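import Summits.ResolutionOfSingularities.ResolutionOfSingularities.Theses.MaxContactCut
import Summits.ResolutionOfSingularities.ResolutionOfSingularities.Theorems.GenericFibreCutClasses
import Summits.ResolutionOfSingularities.ResolutionOfSingularities.Theorems.MaxContactCutTauLadder
import HarnessLib

/-!
# MaxContactCutGenericFibreCut — the g8 node «GenericFibreCut» wired to the route MaxContactCut BY NAME
(decomp-res node N47, lens-2 g8 sha256 2531d302d09f5b30; CRITIC-LEDGER row 54 CLEARED AS MAP NODE rev 2; phase 3)

Vocabulary: `Theorems/GenericFibreCutClasses` (phase 1: `SeqDim d n`, `ReachClosed d n`, `ClosedCore d n`, the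
dictionary ports `DictThree`/`DictTwo`/`SurfacePort`, the pieces `GPieces n`, the p-rank ladder).  Route asides
(MaxContactCut rev 13, all `aside · rank 9`, refining `RungOne` 29273): `GFSeqDimTwoAll` [DECIDED mod SurfacePort],
`GFClosedCoreThreeAll` [UNDECIDED, weaker than 30081 by letter only], `GFDictThreeAll` [port, cheap theorem #13],
`GFDictTwoAll` [port]; the fourfold closed-point core is the EXISTING aside `ClosedPointCoreAll` (30461, g7).

Kernels (all by name, 0 sorry):
* EXACT CUT modulo the dictionary: `E 1 ⟺ GFSeqDimTwoAll ∧ GFClosedCoreThreeAll ∧ ClosedPointCoreAll`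
  (`e_one_iff_gfAsides`; ⟸ uses the two ports, ⟹ is by letter);
* MAP EDGE lens-2 ⟵ lens-3: the companion aside `MaxOrderThreefoldResolution` (30081) gives `SeqDim 3 n`, hence
  `GFClosedCoreThreeAll` and `GFSeqDimTwoAll` BY LETTER, and through `GFDictThreeAll` both g7 rounds 30459/30460;
* g7 ⟷ g8: `RoundCodimThreeAll` (30460) ⟹ `GFClosedCoreThreeAll` by letter, and conversely modulo the ports;
* UP THE LADDER: `RungOne` (29273), `StepDimFour` (28011) via `SequenceToStepAll` (29274), the located core
  `StepPICoreDimFour` (28544) and the dim-4 pencil pocket — from the asides (`closes`), through the map edge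
  (`closes_mapEdge`: 30081 + GFDictThreeAll + 30461 + 29274 ⟹ 28544), and from print (`closes_print`: tree fact
  `Cutkosky2009_thm_6_1` + SurfacePort + ports + cores).
WHY THIS IS NOVEL (critic row 54): the recursion «dim-4 E-problem ⟸ the ladder's own statement in dim 3 and dim 2 over
ALL fields of char p + the closed-point core» closes inside the tree's vocabulary; the only undecided non-residual
piece is typed as `ClosedCore 3 n` and identified with 30081 by letter. Census data: HOME/CRITIC-LEDGER.md row 54;
lens sha256 2531d302d09f5b30. Sources: Cutkosky2009 Thm 6.1 / Rem 6.2; CossartJannsenSaito2020 Thm 1.4 / Cor 1.5;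
CossartPiltant2019 Prop 4.3/4.4; BenitoVillamayor2013; BierstoneGrigorievMilmanWlodarczyk2011 §3.3; Matsumura1987 §26.
-/

namespace Summit.ResolutionOfSingularities.ResolutionOfSingularities.Theorems.MaxContactCutGenericFibreCut

open CategoryTheory AlgebraicGeometry
open Literature.AlgebraicGeometry.Resolution
open Summit.ResolutionOfSingularities.ResolutionOfSingularities.Theses
open Summit.ResolutionOfSingularities.ResolutionOfSingularities.Theorems
open WeakOrderReduction GenericPointCutClasses GenericFibreCutClasses

/-! ## The exact cut modulo the dictionary, BY NAME -/

/-- The g8 pieces at every marking from the three asides. [folklore] -/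
theorem gPieces_of_asides (h2 : MaxContactCut.GFSeqDimTwoAll) (c3 : MaxContactCut.GFClosedCoreThreeAll)
    (c4 : MaxContactCut.ClosedPointCoreAll) : ∀ n : ℕ, 1 ≤ n → GPieces n :=
  fun n hn => ⟨h2 n hn, c3 n hn, c4 n hn⟩

/-- `E 1` from the three asides and the two dictionary ports. [folklore] -/
theorem e_one_of_gfAsides (d3 : MaxContactCut.GFDictThreeAll) (d2 : MaxContactCut.GFDictTwoAll)
    (h2 : MaxContactCut.GFSeqDimTwoAll) (c3 : MaxContactCut.GFClosedCoreThreeAll)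
    (c4 : MaxContactCut.ClosedPointCoreAll) : E 1 :=
  fun n hn => seq_of_gPieces (d3 n hn) (d2 n hn) (gPieces_of_asides h2 c3 c4 n hn)

/-- NECESSITY BY LETTER (no port): `E 1` gives the three asides. [folklore] -/
theorem gfAsides_of_e_one (h : E 1) :
    MaxContactCut.GFSeqDimTwoAll ∧ MaxContactCut.GFClosedCoreThreeAll ∧ MaxContactCut.ClosedPointCoreAll :=
  ⟨fun n hn => (gPieces_of_seq (h n hn)).1, fun n hn => (gPieces_of_seq (h n hn)).2.1,
    fun n hn => (gPieces_of_seq (h n hn)).2.2⟩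

/-- **EXACT CUT modulo the dictionary**: `E 1 ⟺ GFSeqDimTwoAll ∧ GFClosedCoreThreeAll ∧ ClosedPointCoreAll`.
[folklore] -/
theorem e_one_iff_gfAsides (d3 : MaxContactCut.GFDictThreeAll) (d2 : MaxContactCut.GFDictTwoAll) :
    E 1 ↔ MaxContactCut.GFSeqDimTwoAll ∧ MaxContactCut.GFClosedCoreThreeAll ∧ MaxContactCut.ClosedPointCoreAll :=
  ⟨gfAsides_of_e_one, fun h => e_one_of_gfAsides d3 d2 h.1 h.2.1 h.2.2⟩

/-- Given the surface base and the threefold core, the fourfold closed-point core IS `E 1` (the located residual).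
[folklore] -/
theorem closedPointCoreAll_iff_e_one (d3 : MaxContactCut.GFDictThreeAll) (d2 : MaxContactCut.GFDictTwoAll)
    (h2 : MaxContactCut.GFSeqDimTwoAll) (c3 : MaxContactCut.GFClosedCoreThreeAll) :
    MaxContactCut.ClosedPointCoreAll ↔ E 1 :=
  ⟨fun c4 => e_one_of_gfAsides d3 d2 h2 c3 c4, fun h => (gfAsides_of_e_one h).2.2⟩

/-! ## g7 ⟷ g8: the CP-sized round (30460) and the threefold closed-point core -/

/-- g7's round `RoundCodimThreeAll` (30460) gives the threefold closed-point core BY LETTER (stalk dimension).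
[folklore] -/
theorem gfClosedCoreThreeAll_of_roundCodimThreeAll (h : MaxContactCut.RoundCodimThreeAll) :
    MaxContactCut.GFClosedCoreThreeAll :=
  fun n hn => closedCoreThree_of_roundCodimThree (h n hn)

/-- … and conversely modulo the surface base and the two ports: the CP-sized round IS the threefold core.
[folklore] -/
theorem roundCodimThreeAll_iff_gfClosedCoreThreeAll (d3 : MaxContactCut.GFDictThreeAll)
    (d2 : MaxContactCut.GFDictTwoAll) (h2 : MaxContactCut.GFSeqDimTwoAll) :
    MaxContactCut.RoundCodimThreeAll ↔ MaxContactCut.GFClosedCoreThreeAll :=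
  ⟨gfClosedCoreThreeAll_of_roundCodimThreeAll,
    fun c3 n hn => (roundCodimThree_iff_closedCoreThree (d3 n hn) (d2 n hn) (h2 n hn)).mpr (c3 n hn)⟩

/-- Both g7 rounds (30459, 30460) from the surface base, the threefold core and the ports. [folklore] -/
theorem rounds_of_gfAsides (d3 : MaxContactCut.GFDictThreeAll) (d2 : MaxContactCut.GFDictTwoAll)
    (h2 : MaxContactCut.GFSeqDimTwoAll) (c3 : MaxContactCut.GFClosedCoreThreeAll) :
    MaxContactCut.RoundCodimTwoAll ∧ MaxContactCut.RoundCodimThreeAll :=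
  ⟨fun n hn =>
      ((reachClosed_four_iff_rounds n).mp (d3 n hn (seqDim_three_of_pieces (d2 n hn) (h2 n hn) (c3 n hn)))).1,
    fun n hn =>
      ((reachClosed_four_iff_rounds n).mp (d3 n hn (seqDim_three_of_pieces (d2 n hn) (h2 n hn) (c3 n hn)))).2⟩

/-! ## MAP EDGE BY NAME: lens-3's companion aside 30081 feeds dimension 3 -/

/-- **KERNEL · edge lens-2 ⟵ lens-3**: `MaxOrderThreefoldResolutionAt n` (slice of 30081 at marking `n`) gives
`SeqDim 3 n` — boundary `E = []` (`MaxOrderAtomClasses.maxOrderEmpty_of_bdry`), resolutions are weak resolutions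
(`MaxContactCutExhaustion.weakResolution_of_resolution`, `MaxContactCutTauLadder.weakResolution_iff`). [folklore] -/
theorem seqDim_three_of_maxOrderAt {n : ℕ} (h : MaxOrderAtomClasses.MaxOrderThreefoldResolutionAt n) :
    SeqDim 3 n := by
  intro p hp k _ _ Y g hg1 hg2 hg3 hY hY3 I hord
  obtain ⟨t, ht⟩ :=
    MaxOrderAtomClasses.maxOrderEmpty_of_bdry n h p hp k Y g hg1 hg2 hg3 hY (by exact_mod_cast hY3) I hord
  exact ⟨t, (MaxContactCutTauLadder.weakResolution_iff t _).mpr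
    (MaxContactCutExhaustion.weakResolution_of_resolution t _ ht)⟩

/-- The companion aside 30081 BY NAME gives `SeqDim 3 n` at every marking `n ≥ 1`. [folklore] -/
theorem seqDim_three_of_item (h : MaxContactCut.MaxOrderThreefoldResolution) {n : ℕ} (hn : 1 ≤ n) : SeqDim 3 n :=
  seqDim_three_of_maxOrderAt (h n hn)

/-- … hence the threefold closed-point core aside BY LETTER (30081 ⟹ GFClosedCoreThreeAll). [folklore] -/
theorem gfClosedCoreThreeAll_of_item (h : MaxContactCut.MaxOrderThreefoldResolution) :
    MaxContactCut.GFClosedCoreThreeAll :=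
  fun _ hn => closedCore_of_seqDim (seqDim_three_of_item h hn)

/-- … the surface base BY LETTER (dim ≤ 2 ≤ 3; 30081 ⟹ GFSeqDimTwoAll). [folklore] -/
theorem gfSeqDimTwoAll_of_item (h : MaxContactCut.MaxOrderThreefoldResolution) : MaxContactCut.GFSeqDimTwoAll :=
  fun _ hn => seqDim_mono (by norm_num) (seqDim_three_of_item h hn)

/-- … and, through the port `GFDictThreeAll`, BOTH g7 rounds 30459/30460 (g7's CP-sized round inherits the status
of lens-3's 30081: critic row 46 KNOWN-MOD-PORT). [folklore] -/
theorem rounds_of_item (h : MaxContactCut.MaxOrderThreefoldResolution) (d3 : MaxContactCut.GFDictThreeAll) :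
    MaxContactCut.RoundCodimTwoAll ∧ MaxContactCut.RoundCodimThreeAll :=
  ⟨fun n hn => ((reachClosed_four_iff_rounds n).mp (d3 n hn (seqDim_three_of_item h hn))).1,
    fun n hn => ((reachClosed_four_iff_rounds n).mp (d3 n hn (seqDim_three_of_item h hn))).2⟩

/-! ## Up the ladder BY NAME: `RungOne` (29273), `StepDimFour` (28011), `StepPICoreDimFour` (28544), the pencil -/

/-- The route item `MaxContactCut.RungOne` (29273, `E 2 → E 1`) from the asides and ports. [folklore] -/
theorem rungOne_of_gfAsides (d3 : MaxContactCut.GFDictThreeAll) (d2 : MaxContactCut.GFDictTwoAll)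
    (h2 : MaxContactCut.GFSeqDimTwoAll) (c3 : MaxContactCut.GFClosedCoreThreeAll)
    (c4 : MaxContactCut.ClosedPointCoreAll) : MaxContactCut.RungOne :=
  fun _ => e_one_of_gfAsides d3 d2 h2 c3 c4

/-- Given `E 2` and everything but the fourfold core, `RungOne` IS the fourfold closed-point core. [folklore] -/
theorem rungOne_iff_closedPointCoreAll (hE2 : E 2) (d3 : MaxContactCut.GFDictThreeAll)
    (d2 : MaxContactCut.GFDictTwoAll) (h2 : MaxContactCut.GFSeqDimTwoAll) (c3 : MaxContactCut.GFClosedCoreThreeAll) :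
    MaxContactCut.RungOne ↔ MaxContactCut.ClosedPointCoreAll :=
  ⟨fun h => (gfAsides_of_e_one (h hE2)).2.2, fun c4 => rungOne_of_gfAsides d3 d2 h2 c3 c4⟩

/-- `StepDimFour` (28011) from the asides, the ports and the costume step-glue `SequenceToStepAll` (29274).
[folklore] -/
theorem stepDimFour_of_gfAsides (d3 : MaxContactCut.GFDictThreeAll) (d2 : MaxContactCut.GFDictTwoAll)
    (h2 : MaxContactCut.GFSeqDimTwoAll) (c3 : MaxContactCut.GFClosedCoreThreeAll)
    (c4 : MaxContactCut.ClosedPointCoreAll) (hS : MaxContactCut.SequenceToStepAll) : MaxContactCut.StepDimFour :=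
  hS (e_one_of_gfAsides d3 d2 h2 c3 c4)

/-- **DECIDING IMPLICATION of the node**: the located core `StepPICoreDimFour` (28544) BY NAME from the surface base,
the two closed-point cores, the two ports and the step-glue 29274. [folklore] -/
theorem closes (d3 : MaxContactCut.GFDictThreeAll) (d2 : MaxContactCut.GFDictTwoAll)
    (h2 : MaxContactCut.GFSeqDimTwoAll) (c3 : MaxContactCut.GFClosedCoreThreeAll)
    (c4 : MaxContactCut.ClosedPointCoreAll) (hS : MaxContactCut.SequenceToStepAll) :
    MaxContactCut.StepPICoreDimFour :=
  MaxContactCutTauLadder.stepPICoreDimFour_of_stepDimFour (stepDimFour_of_gfAsides d3 d2 h2 c3 c4 hS)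

/-- All dim-4 classes of MaxContactCut BY NAME (28011, 28009, 28010, 28543, 28544) from the same hypotheses.
[folklore] -/
theorem closes_items (d3 : MaxContactCut.GFDictThreeAll) (d2 : MaxContactCut.GFDictTwoAll)
    (h2 : MaxContactCut.GFSeqDimTwoAll) (c3 : MaxContactCut.GFClosedCoreThreeAll)
    (c4 : MaxContactCut.ClosedPointCoreAll) (hS : MaxContactCut.SequenceToStepAll) :
    MaxContactCut.StepDimFour ∧ MaxContactCut.StepContactDimFour ∧ MaxContactCut.StepContactFreeDimFour ∧
      MaxContactCut.StepCFHigherDimFour ∧ MaxContactCut.StepPICoreDimFour :=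
  have hD : MaxContactCut.StepDimFour := stepDimFour_of_gfAsides d3 d2 h2 c3 c4 hS
  ⟨hD, MaxContactCutTauCut.stepContactDimFour_of_stepDimFour hD,
    MaxContactCutTauCut.stepContactFreeDimFour_of_stepDimFour hD,
    MaxContactCutTauLadder.stepCFHigherDimFour_of_stepDimFour hD,
    MaxContactCutTauLadder.stepPICoreDimFour_of_stepDimFour hD⟩

/-- **DECIDING IMPLICATION THROUGH THE MAP EDGE**: 30081 (KNOWN-MOD-PORT, row 46), the port `GFDictThreeAll`, the
fourfold closed-point core 30461 (THE residual) and the step-glue 29274 give 28544 BY NAME. [folklore] -/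
theorem closes_mapEdge (h81 : MaxContactCut.MaxOrderThreefoldResolution) (d3 : MaxContactCut.GFDictThreeAll)
    (c4 : MaxContactCut.ClosedPointCoreAll) (hS : MaxContactCut.SequenceToStepAll) :
    MaxContactCut.StepPICoreDimFour :=
  MaxContactCutTauLadder.stepPICoreDimFour_of_stepDimFour
    (hS fun n hn => (seqDim_four_iff n).mp
      (seqDim_of_reachClosed_of_closedCore (d3 n hn (seqDim_three_of_item h81 hn))
        ((closedCore_four_iff n).mpr (c4 n hn))))

/-- **DECIDING IMPLICATION FROM PRINT**: Cutkosky's Thm 6.1 (tree fact `Cutkosky2009_thm_6_1`), the surface port, the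
two dictionary ports, the two closed-point cores and the step-glue give 28544 BY NAME. [folklore] -/
theorem closes_print (c61 : Cutkosky2009_thm_6_1.{0}) (sp : ∀ n : ℕ, 1 ≤ n → SurfacePort n)
    (d3 : MaxContactCut.GFDictThreeAll) (d2 : MaxContactCut.GFDictTwoAll)
    (c3 : MaxContactCut.GFClosedCoreThreeAll) (c4 : MaxContactCut.ClosedPointCoreAll)
    (hS : MaxContactCut.SequenceToStepAll) : MaxContactCut.StepPICoreDimFour :=
  closes d3 d2 (fun n hn => sp n hn c61) c3 c4 hS

/-- The dim-4 pencil pocket `OrderCut.PencilResolveDimFour` (27135) BY NAME, modulo the OrderCut costumes `OrderBound`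
(28006) and `LocalOrderOneResolveDimFour` (28008). [folklore] -/
theorem pencil_of_gfAsides (hB : MaxContactCut.OrderBound) (h1 : MaxContactCut.LocalOrderOneResolveDimFour)
    (d3 : MaxContactCut.GFDictThreeAll) (d2 : MaxContactCut.GFDictTwoAll) (h2 : MaxContactCut.GFSeqDimTwoAll)
    (c3 : MaxContactCut.GFClosedCoreThreeAll) (c4 : MaxContactCut.ClosedPointCoreAll)
    (hS : MaxContactCut.SequenceToStepAll) : OrderCut.PencilResolveDimFour :=
  MaxContactCutTauLadder.pencilResolveDimFour_of_step hB h1 (stepDimFour_of_gfAsides d3 d2 h2 c3 c4 hS)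

/-- COMPATIBILITY WITH THE τ-LADDER: fed in above the core only, the g8 asides replace exactly `RungOne`.
[folklore] -/
theorem e_one_of_ladder_and_gfAsides (h5 : MaxContactCutExhaustion.ContactOrderSequenceDimFour)
    (r4 : MaxContactCut.RungFour) (r3 : MaxContactCut.RungThree) (r2 : MaxContactCut.RungTwo)
    (d3 : MaxContactCut.GFDictThreeAll) (d2 : MaxContactCut.GFDictTwoAll) (h2 : MaxContactCut.GFSeqDimTwoAll)
    (c3 : MaxContactCut.GFClosedCoreThreeAll) (c4 : MaxContactCut.ClosedPointCoreAll) : E 1 :=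
  MaxContactCutTauLadder.e_one_of_ladder h5 r4 r3 r2 (rungOne_of_gfAsides d3 d2 h2 c3 c4)

/-! ## The perfect column of the p-rank ladder, BY NAME -/

/-- On the PERFECT column (tree `SeqDimFourPerfect 1 n` = `MaxContactCut.WeakOrderReductionPerfect` slice-wise) the
GRADED ports, surfaces (all fields), the threefold core aside and the fourfold core give the perfect slice at every
marking; the sharper statement with the threefold core only over fields of p-RANK ONE (`ClosedCoreP 3 1 n`) is
`GenericFibreCutClasses.perfectColumn_of_pieces` (critic row 54: located sharpening, desk T-prank). [folklore] -/
theorem perfectColumn_of_gfAsides (d3 : ∀ n : ℕ, 1 ≤ n → DictThreeP 0 n) (d2 : ∀ n : ℕ, 1 ≤ n → DictTwoP 0 n)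
    (h2 : MaxContactCut.GFSeqDimTwoAll) (c3 : MaxContactCut.GFClosedCoreThreeAll)
    (c4 : MaxContactCut.ClosedPointCoreAll) {n : ℕ} (hn : 1 ≤ n) : SeqDimFourPerfect 1 n :=
  perfectColumn_of_gPieces (d3 n hn) (d2 n hn) (gPieces_of_asides h2 c3 c4 n hn)

end Summit.ResolutionOfSingularities.ResolutionOfSingularities.Theorems.MaxContactCutGenericFibreCut
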